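import Summits.QuantumFields.BalabanUV.Beta.GAN24.RespStepEffectiveEL
import Summits.QuantumFields.BalabanUV.Beta.GAN24.StencilSlotLam

/-!
# `BalabanUV.Beta.GAN24.LagrangeHessianTransferUnits` — binder row G-an2-4 ∕ (CONV-C), CT-ROUTE, BORNSEC Λ half: THE STEP LAGRANGE COEFFICIENT IN THE
# K-SLOT'S UNITS — `E″`-ENTRY FORMS AND THE FULL-RATE `j`-UNIFORM LETTER (the row owner's WORD (W9) «O-gan24leaf03-g53-1 = WANTED», `CLAIMS.log` l.33389)

NOT IN PRINT; OUR BOOKKEEPING (G-an2-4 formalisation swarm → CRUX TEAM (2), leaf prover `b2b-balaban-gan24-formalise-leaf-03`, gen 53).  [folklore] units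
bookkeeping and ONE triangle inequality over tree theorems BY NAME: the row owner's `RespStepEffectiveEL.lamCoeffK_KInvStep_E2_eq_neg_contourSumAdj` (p288900:
the step Lagrange coefficient is a tent of the next-level multiplier column — located item X-gan24p1-g20-1; leaf-03's independent derivation `LagrangeHessianTransfer`
twin 3a3856104dd2aa63 agrees after `HΦcol_apply`), the owner's `StencilSlotLam.lamCoeffK_unit` ∕ `E2_inr` ∕ `smul_E2_succ_inl_inl`, an2's `E2` ∕ `mmRead_inl_inl`,
`OneStepResolventKernel.KInv_inr_inr_coarse` ∕ `l1_zsmul_sub_le`, `KKTFluctuationEnergy.contourSumAdj_eq`.  0 `def`, 0 cited facts, 0 `def … : Prop`, 0 sorry; NO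
estimate of Bałaban's.  HONEST FRAMING (cell contract, verbatim): «discharging `BetaPertH` makes Bałaban's UV stability UNCONDITIONAL — a real constructive-QFT
result; it is NOT the continuum limit and NOT the Clay problem.»  HONEST DEPENDENCY (verbatim): «continuum YM on T⁴ ⇐ BetaPertH ∧ nine spine estimates (0/9 proved);
BetaPertH ⇐ (D1) ∧ (D4) ∧ CAP+tail; G-an2-4 gates asym, D1 and NE2/3/4.»  Discharges NO slot letter of (CONV-C) by itself; hB OPEN; NEVER «G-an2-4 closed»; NOT D1,
NOT `BetaPertH`, NOT continuum, NOT Clay.  The owner's `GAN24/BornLambdaTent` carries the `contourSumAdj`-of-unit-`wΦ` (tent) form of the unit transfer; THIS file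
carries only the `E″`-ENTRY ∕ `KStepUnit`-ENTRY sum forms (which dock on leaf-01's `BornLambdaContactCells` coefficients with no unit conversion) and the letter.

## What is proved (generic `d`; `Lc` with `NeZero Lc`; every `j`)
* §1 `E2_succ_entry_eq_wΦ` (dictionary) and **`lamCoeffK_KInvStep_E2_eq_sum`**:
  `lamCoeffK (KInvStep Lc j) (E2 d Lc j) Lc μ y κ′ u′ = −((Lc^j)^{d+2})⁻¹ · Σ_{s<Lc} E2 d Lc (j+1) (quo Lc (u′ − s•e_{κ′})) y (inl κ′) (inl μ)` (the owner's tent, entry by entry).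
* §2 `unit_factor_transfer` (`s_m(j+1)·s_f(j+1)·s_m(j)²·((Lc^{j+1})^{d+2})⁻¹ = (Lc^{2(d+1)})⁻¹·s_m(j+1)²`), **`lamCoeffK_KStepUnit_E2unit`**:
  `lamCoeffK (KStepUnit Lc (j+1)) ((smStep d Lc j)² • E2 d Lc (j+1)) Lc μ y κ′ u′ = −(Lc^{2(d+1)})⁻¹ · Σ_{s<Lc} ((smStep d Lc (j+1))² • E2 d Lc (j+2)) (quo Lc (u′ − s•e_{κ′})) y (inl κ′) (inl μ)`
  — a `j`-FREE factor times the NEXT unit-normalised value Hessian's entries — and **`lamCoeffK_KStepUnit_eq_sum_KStepUnit`** (the same through `KStepUnit Lc (j+1)`'s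
  multiplier block, `smul_E2_succ_inl_inl`).
* §3 `l1_pullback_le` (`|Lc•y − u′|₁ ≤ |Lc•quo(u′ − s e_{κ′}) − Lc•y|₁ + Lc(d+2)` for `s < Lc`) and **`abs_lamCoeffK_KStepUnit_le`**: under the K-slot
  `UnitDecayK d Lc (sfStep Lc) (smStep d Lc) C δ` (`0 ≤ δ`; a HYPOTHESIS here — concluded for `d = 3` by road P1's `FibreStrip.unitDecayK_holds`), for EVERY `j`,
  `|lamCoeffK (KStepUnit Lc (j+1)) ((smStep d Lc j)² • E2 d Lc (j+1)) Lc μ y κ′ u′| ≤ ((Lc^{2(d+1)})⁻¹·(Lc·(C·e^{δ·(Lc·(d+2))})))·e^{−δ·|Lc•y − u′|₁}` — ONE `j`-free constant,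
  the FULL rate `δ`, in the `hc`-shape of `InterLevelTransport.locStencil_SLam` (the generic route `abs_lamCoeffK_le ∘ decays_E2unit` gives `δ∕2`).
-/

noncomputable section

open Finset
open scoped BigOperators

open Literature.MathematicalPhysics.QuantumFieldTheory
open Literature.MathematicalPhysics.QuantumFieldTheory.Balaban1983to89
open Literature.MathematicalPhysics.QuantumFieldTheory.Balaban1983to89.Beta
open LatticeForm (quo)
open AffineAveraging (unitVec)
open AffineReproduction (contourSumAdj)
open KernelSpecInstance (wΦ)
open KKTFluctuationEnergy (contourSumAdj_eq)
open OneStepResolventKernel (Fib KInv KInv_inr_inr_coarse l1_zsmul_sub_le)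
open OneStepKernelFamily (KInvStep)
open BalabanStepJetsSucc (lamCoeffK E2 mmRead mmRead_inl_inl)
open ExpKernelCalculus (MKer Decays l1_natSmul l1_sub_triangle)
open B12Sec2to5 (l1 l1_nonneg)
open Summit.QuantumFields.BalabanUV.Beta.HessKerDressedUnits (unitK)
open Summit.QuantumFields.BalabanUV.Beta.GAN24.CombesThomas (sfStep smStep sfStep_ne_zero smStep_ne_zero KStepUnit UnitDecayK)
open Summit.QuantumFields.BalabanUV.Beta.GAN24.StencilSlotLam (E2_inr lamCoeffK_unit smul_E2_succ_inl_inl)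
open Summit.QuantumFields.BalabanUV.Beta.GAN24.RespStepEffectiveEL (lamCoeffK_KInvStep_E2_eq_neg_contourSumAdj)

namespace Summit.QuantumFields.BalabanUV.Beta.GAN24.LagrangeHessianTransferUnits

variable {d : ℕ} (Lc : ℕ) [NeZero Lc]

/-! ## §1 The owner's tent, entry by entry of the next value Hessian -/

/-- [folklore] DICTIONARY: `E2 d Lc (j+1) v y (inl ν) (inl μ) = wΦ_{Lc^{j+1}} ν μ (v − y)` (`mmRead_inl_inl`, `KInv_inr_inr_coarse`). -/
theorem E2_succ_entry_eq_wΦ (j : ℕ) (μ : Fin (d + 1)) (y : Fin (d + 1) → ℤ) (ν : Fin (d + 1)) (v : Fin (d + 1) → ℤ) :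
    E2 d Lc (j + 1) v y (Sum.inl ν) (Sum.inl μ) = wΦ (N := Lc ^ (j + 1)) (d := d) ν μ (v - y) := by
  rw [E2, mmRead_inl_inl, KInv_inr_inr_coarse]

/-- NOT IN PRINT; OUR BOOKKEEPING.  **THE STEP LAGRANGE COEFFICIENT, ENTRY BY ENTRY OF THE NEXT VALUE HESSIAN** (the owner's
`lamCoeffK_KInvStep_E2_eq_neg_contourSumAdj` with the tent unfolded and the dictionary applied):
`lamCoeffK (KInvStep Lc j) (E2 d Lc j) Lc μ y κ′ u′ = −((Lc^j)^{d+2})⁻¹ · Σ_{s<Lc} E2 d Lc (j+1) (quo Lc (u′ − s•e_{κ′})) y (inl κ′) (inl μ)`. -/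
theorem lamCoeffK_KInvStep_E2_eq_sum (j : ℕ) (μ : Fin (d + 1)) (y : Fin (d + 1) → ℤ) (κ' : Fin (d + 1)) (u' : Fin (d + 1) → ℤ) :
    lamCoeffK (KInvStep (d := d) Lc j) (E2 d Lc j) Lc μ y κ' u'
      = -((((Lc ^ j : ℕ) : ℝ) ^ (d + 2))⁻¹
          * ∑ s ∈ Finset.range Lc, E2 d Lc (j + 1) (quo Lc (u' - (s : ℤ) • unitVec κ')) y (Sum.inl κ') (Sum.inl μ)) := by
  rw [lamCoeffK_KInvStep_E2_eq_neg_contourSumAdj, contourSumAdj_eq]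
  simp only [E2_succ_entry_eq_wΦ]

/-! ## §2 The unit-normalised forms (the currency of `StencilSlotLam.unitS_lamPiece_eq` ∕ `BornLambdaLineage.unitS_freshAt_lam_succ`) -/

/-- [folklore] Units count: `s_m(j+1)·s_f(j+1)·s_m(j)²·((Lc^{j+1})^{d+2})⁻¹ = (Lc^{2(d+1)})⁻¹·s_m(j+1)²` (`s_f(n) = Lc^n`, `s_m(n) = Lc^{n(d+1)}`). -/
theorem unit_factor_transfer (j : ℕ) :
    smStep d Lc (j + 1) * sfStep Lc (j + 1) * (smStep d Lc j) ^ 2 * ((((Lc ^ (j + 1) : ℕ) : ℝ) ^ (d + 2))⁻¹)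
      = (((Lc : ℝ) ^ (2 * (d + 1)))⁻¹) * (smStep d Lc (j + 1)) ^ 2 := by
  have hL : (Lc : ℝ) ≠ 0 := Nat.cast_ne_zero.2 (NeZero.ne Lc)
  simp only [smStep, sfStep, Nat.cast_pow]
  rw [← pow_mul, ← pow_mul, ← pow_mul]
  field_simp
  rw [← pow_add, ← pow_add, ← pow_add, ← pow_add]
  congr 1
  ring

/-- NOT IN PRINT; OUR BOOKKEEPING.  **THE UNIT-NORMALISED STEP LAGRANGE COEFFICIENT IS A `j`-FREE MULTIPLE OF THE NEXT UNIT VALUE HESSIAN'S ENTRIES**: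
`lamCoeffK (KStepUnit Lc (j+1)) ((smStep d Lc j)² • E2 d Lc (j+1)) Lc μ y κ′ u′
   = −(Lc^{2(d+1)})⁻¹ · Σ_{s<Lc} ((smStep d Lc (j+1))² • E2 d Lc (j+2)) (quo Lc (u′ − s•e_{κ′})) y (inl κ′) (inl μ)`
(the owner's `lamCoeffK_unit` + §1 at `j+1` + `unit_factor_transfer`; it docks on leaf-01's `BornLambdaContactCells` coefficients with no unit conversion). -/
theorem lamCoeffK_KStepUnit_E2unit (j : ℕ) (μ : Fin (d + 1)) (y : Fin (d + 1) → ℤ) (κ' : Fin (d + 1)) (u' : Fin (d + 1) → ℤ) :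
    lamCoeffK (KStepUnit (d := d) Lc (j + 1)) ((smStep d Lc j) ^ 2 • E2 d Lc (j + 1)) Lc μ y κ' u'
      = -(((Lc : ℝ) ^ (2 * (d + 1)))⁻¹
          * ∑ s ∈ Finset.range Lc,
              ((smStep d Lc (j + 1)) ^ 2 • E2 d Lc (j + 2)) (quo Lc (u' - (s : ℤ) • unitVec κ')) y (Sum.inl κ') (Sum.inl μ)) := by
  have hsf := sfStep_ne_zero (Lc := Lc) (j + 1)
  have hsm := smStep_ne_zero (d := d) (Lc := Lc) (j + 1)
  have hsm0 : smStep d Lc j ≠ 0 := smStep_ne_zero (d := d) (Lc := Lc) j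
  have ht : (smStep d Lc j) ^ 2 ≠ 0 := pow_ne_zero _ hsm0
  have hu := lamCoeffK_unit hsf hsm ht (KInvStep (d := d) Lc (j + 1)) (E2 d Lc (j + 1)) (E2_inr (Lc := Lc) (j + 1)) Lc μ y κ' u'
  have hone : (smStep d Lc (j + 1) * sfStep Lc (j + 1) * (smStep d Lc j) ^ 2)
      * ((smStep d Lc (j + 1) * sfStep Lc (j + 1))⁻¹ * ((smStep d Lc j) ^ 2)⁻¹) = 1 := by
    field_simp
  have hu' : lamCoeffK (KStepUnit (d := d) Lc (j + 1)) ((smStep d Lc j) ^ 2 • E2 d Lc (j + 1)) Lc μ y κ' u'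
      = (smStep d Lc (j + 1) * sfStep Lc (j + 1) * (smStep d Lc j) ^ 2)
          * lamCoeffK (KInvStep (d := d) Lc (j + 1)) (E2 d Lc (j + 1)) Lc μ y κ' u' := by
    rw [hu, ← mul_assoc, hone, one_mul]
  rw [hu', lamCoeffK_KInvStep_E2_eq_sum, show j + 1 + 1 = j + 2 from rfl]
  have hfac := unit_factor_transfer (d := d) Lc j
  rw [mul_neg, ← mul_assoc, hfac, mul_assoc, Finset.mul_sum]
  simp only [Pi.smul_apply, smul_eq_mul]

/-- NOT IN PRINT; OUR BOOKKEEPING.  **THE SAME THROUGH THE NEXT UNIT-NORMALISED STEP RESOLVENT** (the owner's `E″`-dictionary `smul_E2_succ_inl_inl`):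
`lamCoeffK (KStepUnit Lc (j+1)) ((smStep d Lc j)² • E2 d Lc (j+1)) Lc μ y κ′ u′ = −(Lc^{2(d+1)})⁻¹ · Σ_{s<Lc} KStepUnit Lc (j+1) (Lc • quo Lc (u′ − s•e_{κ′})) (Lc • y) (inr κ′) (inr μ)`. -/
theorem lamCoeffK_KStepUnit_eq_sum_KStepUnit (j : ℕ) (μ : Fin (d + 1)) (y : Fin (d + 1) → ℤ) (κ' : Fin (d + 1))
    (u' : Fin (d + 1) → ℤ) :
    lamCoeffK (KStepUnit (d := d) Lc (j + 1)) ((smStep d Lc j) ^ 2 • E2 d Lc (j + 1)) Lc μ y κ' u'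
      = -(((Lc : ℝ) ^ (2 * (d + 1)))⁻¹
          * ∑ s ∈ Finset.range Lc,
              KStepUnit (d := d) Lc (j + 1) ((Lc : ℤ) • quo Lc (u' - (s : ℤ) • unitVec κ')) ((Lc : ℤ) • y)
                (Sum.inr κ') (Sum.inr μ)) := by
  rw [lamCoeffK_KStepUnit_E2unit]
  simp only [smul_E2_succ_inl_inl]

/-! ## §3 The `j`-uniform full-rate letter from the K-slot -/

/-- [folklore] `ℓ¹` bookkeeping for the pull-back: for `s < Lc`, `|Lc•y − u′|₁ ≤ |Lc•quo Lc (u′ − s e_{κ′}) − Lc•y|₁ + Lc·(d+2)`. -/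
theorem l1_pullback_le (κ' : Fin (d + 1)) (u' y : Fin (d + 1) → ℤ) {s : ℕ} (hs : s < Lc) :
    l1 ((Lc : ℤ) • y - u') ≤ l1 ((Lc : ℤ) • quo Lc (u' - (s : ℤ) • unitVec κ') - (Lc : ℤ) • y) + (Lc : ℝ) * (d + 2) := by
  have h1 : l1 ((Lc : ℤ) • y - u')
      ≤ l1 ((Lc : ℤ) • y - (u' - (s : ℤ) • unitVec κ')) + l1 ((u' - (s : ℤ) • unitVec κ') - u') :=
    l1_sub_triangle _ _ _
  have he : l1 (unitVec κ' : Fin (d + 1) → ℤ) = 1 := by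
    unfold B12Sec2to5.l1
    have h : ∀ i : Fin (d + 1), |((unitVec κ' i : ℤ) : ℝ)| = if i = κ' then 1 else 0 := by
      intro i; by_cases hi : i = κ' <;> simp [hi]
    simp only [h, Finset.sum_ite_eq', Finset.mem_univ, if_true]
  have h2 : l1 ((u' - (s : ℤ) • unitVec κ') - u') = s := by
    rw [show (u' - (s : ℤ) • unitVec κ') - u' = -((s : ℤ) • unitVec κ') by abel, OneStepKernelFamily.l1_neg_eq,
      l1_natSmul, he, mul_one]
  have h3 : l1 ((Lc : ℤ) • y - (u' - (s : ℤ) • unitVec κ'))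
      ≤ (Lc : ℝ) * l1 (y - quo Lc (u' - (s : ℤ) • unitVec κ')) + (Lc : ℝ) * (d + 1) :=
    l1_zsmul_sub_le (N := Lc) y _
  have h4 : l1 ((Lc : ℤ) • quo Lc (u' - (s : ℤ) • unitVec κ') - (Lc : ℤ) • y)
      = (Lc : ℝ) * l1 (y - quo Lc (u' - (s : ℤ) • unitVec κ')) := by
    rw [← smul_sub, l1_natSmul, ← OneStepKernelFamily.l1_neg_eq, neg_sub]
  have hs' : (s : ℝ) ≤ Lc := by exact_mod_cast hs.le
  rw [h4]
  nlinarith [h1, h2, h3, hs', l1_nonneg ((Lc : ℤ) • y - (u' - (s : ℤ) • unitVec κ'))]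

/-- NOT IN PRINT; OUR BOOKKEEPING ((V7) ∕ Q11 ∕ (R1) letter, FULL RATE).  **`j`-UNIFORM DECAY OF THE UNIT-NORMALISED STEP LAGRANGE COEFFICIENT FROM THE K-SLOT**:
if `UnitDecayK d Lc (sfStep Lc) (smStep d Lc) C δ` (`0 ≤ δ`), then for EVERY `j`, `μ`, `y`, `κ′`, `u′`,
`|lamCoeffK (KStepUnit Lc (j+1)) ((smStep d Lc j)² • E2 d Lc (j+1)) Lc μ y κ′ u′| ≤ ((Lc^{2(d+1)})⁻¹·(Lc·(C·e^{δ·(Lc·(d+2))})))·e^{−δ·|Lc•y − u′|₁}` —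
ONE `j`-free constant and the FULL rate `δ` (§2 + `l1_pullback_le`). -/
theorem abs_lamCoeffK_KStepUnit_le {C δ : ℝ} (hK : UnitDecayK d Lc (sfStep Lc) (smStep d Lc) C δ) (hδ : 0 ≤ δ) (j : ℕ)
    (μ : Fin (d + 1)) (y : Fin (d + 1) → ℤ) (κ' : Fin (d + 1)) (u' : Fin (d + 1) → ℤ) :
    |lamCoeffK (KStepUnit (d := d) Lc (j + 1)) ((smStep d Lc j) ^ 2 • E2 d Lc (j + 1)) Lc μ y κ' u'|
      ≤ (((Lc : ℝ) ^ (2 * (d + 1)))⁻¹ * ((Lc : ℝ) * (C * Real.exp (δ * ((Lc : ℝ) * (d + 2))))))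
          * Real.exp (-δ * l1 ((Lc : ℤ) • y - u')) := by
  have hC : 0 ≤ C := (hK 0).nonneg (Sum.inl 0)
  have hLpos : (0 : ℝ) < (Lc : ℝ) := by exact_mod_cast Nat.pos_of_ne_zero (NeZero.ne Lc)
  rw [lamCoeffK_KStepUnit_eq_sum_KStepUnit, abs_neg, abs_mul, abs_inv, abs_pow, abs_of_pos hLpos]
  have hterm : ∀ s ∈ Finset.range Lc,
      |KStepUnit (d := d) Lc (j + 1) ((Lc : ℤ) • quo Lc (u' - (s : ℤ) • unitVec κ')) ((Lc : ℤ) • y)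
          (Sum.inr κ') (Sum.inr μ)|
        ≤ C * Real.exp (δ * ((Lc : ℝ) * (d + 2))) * Real.exp (-δ * l1 ((Lc : ℤ) • y - u')) := by
    intro s hs
    rw [Finset.mem_range] at hs
    refine (hK (j + 1) _ _ _ _).trans ?_
    rw [mul_assoc, ← Real.exp_add]
    refine mul_le_mul_of_nonneg_left (Real.exp_le_exp.2 ?_) hC
    have h := l1_pullback_le (d := d) Lc κ' u' y hs
    nlinarith [h, hδ]
  have hsum := (Finset.abs_sum_le_sum_abs _ _).trans (Finset.sum_le_sum hterm)
  rw [Finset.sum_const, Finset.card_range, nsmul_eq_mul] at hsum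
  calc (((Lc : ℝ) ^ (2 * (d + 1))))⁻¹ * |∑ s ∈ Finset.range Lc,
          KStepUnit (d := d) Lc (j + 1) ((Lc : ℤ) • quo Lc (u' - (s : ℤ) • unitVec κ')) ((Lc : ℤ) • y) (Sum.inr κ') (Sum.inr μ)|
      ≤ (((Lc : ℝ) ^ (2 * (d + 1))))⁻¹
          * ((Lc : ℝ) * (C * Real.exp (δ * ((Lc : ℝ) * (d + 2))) * Real.exp (-δ * l1 ((Lc : ℤ) • y - u')))) :=
        mul_le_mul_of_nonneg_left hsum (by positivity)
    _ = _ := by ring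

end Summit.QuantumFields.BalabanUV.Beta.GAN24.LagrangeHessianTransferUnits

end
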